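import Literature.AnabelianGeometry.EtaleTheta.ArithThetaTowerRealified
import Literature.AnabelianGeometry.EtaleTheta.Discharge.Sec3Prop34iiNode
import HarnessLib

/-!
# [EtTh] Prop. 3.4 (ii), isomorphism 2 («effective log-divisor ⇒ constant») AT THE ⊕ CARRIER `ArithThetaTower.divisorMonoids d T`
# and at the term's realified data `T' := ArithThetaTower.realified d T` (GAP A, item GA-02 add-on 2 — the r1–r3 residuals BY NAME)

S. Mochizuki, *The étale theta function and its Frobenioid-theoretic manifestations*, Publ. RIMS **45** (2009) [MochizukiEtTh2009],
Prop. 3.4 (ii) PDF p.74 («we have natural isomorphisms `𝒪_L^× ⥲ Ker(B₀(Y^log) → Φ₀(Y^log)^gp)`; `𝒪_L^▷ ⥲ B₀(Y^log) ×_{Φ₀(Y^log)^gp} Φ₀(Y^log)`;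
`L^× ⥲ F₀(Y^log) ⊆ B₀(Y^log)`») [cite: MochizukiEtTh2009, Prop 3.4 (ii) p.74], Def. 3.3 (iii) p.73, Def. 3.6 (i) p.76, Rmk. 3.3.1 p.73;
[IUTchI] Ex. 3.2 (i)–(iii) pp.69–71 (the tempered Frobenioid `ℱ̲_v̲` at a bad place) [claim: Mochizuki2012, status: disputed — nothing of the
series is asserted].

abc-iut cell, GAP A = G-L5-EX32I-1, item **GA-02** (seat abc-iut-gapA-02-divisorMonoids, gen 2): PROOF-ONLY add-on to ★ p671144
`ArithThetaTowerCarrier.lean` / ★ p672371 `ArithThetaTowerRealified.lean` (landed files are append-only, so the add-on is a new file).  It supplies,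
BY NAME, the three `T'`-level print clauses that the downstream one-calls (`cor38ii_h5_of_carrierSpec`, `cor38ii_hR`,
`hull_selfEquivalence_of_carrierSpec_of_pullDichotomy_of_isSlimGroup`) take as INSTANCE-form hypotheses on the given Def. 3.6 (i) data, read at
the term `T' := realified d T` (spec-keeper A, precisions (P2) r1–r3):

* **r1 `hP34Λ`** — Prop. 3.4 (ii), ISOMORPHISM 2: an element of `B₀^Λ(Y)` whose image in `(Φ₀^ℝ)^gp(Y)` is EFFECTIVE lies in `F₀^Λ(Y)`.  GA-02's landed
  `divisorMonoids_ker_div₀_le_F₀` is the case «divisor `= 1`» only (isomorphism 1); here the effective case, in three layers: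
  `DivisorMonoids.prod_mem_F₀_of_div₀_eq_of` (isomorphism 2 is PRODUCT-STABLE, from `prodDiv₀_fst/_snd` ★ p669698),
  `ArithThetaTower.divisorMonoidsOf_mem_F₀_of_div₀_eq_of` (the ENGINE, for EVERY geometric input `(Z, A)` with NO hypothesis on `Z`: the constants'
  `F₀ = ⊤`, and an equivariant family with effective «log-divisor of zeroes and poles» takes values in `𝒪^▷ ⊆ L^×` — abc-iut-w6-d058's
  `mem_fZero_of_divZeroHom_eq_of`), **`ArithThetaTower.divisorMonoids_mem_F₀_of_div₀_eq_of d T`** (THE ⊕ CARRIER: exactly the `hP34ii` shape of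
  `RealifiedDivisorMonoids.ofRlfZWeak_mem_FΛ_of_divΛ_eq_of_iso₂`), and at the term **`ArithThetaTower.realified_mem_FΛ_of_divΛ_eq_of d T`** (the
  `hP34Λ` binder VERBATIM at `T' := realified d T`; engine twin `realifiedOf_mem_FΛ_of_divΛ_eq_of`).  At the decreed theta envelope the geometric
  component is even TRIVIAL (`divisorMonoids_snd_eq_one_of_div₀_eq_of`: `𝒪^▷ = 1` there, `envelope_intConst_eq_bot`).
* **r2 `hFinv`** — `F₀^Λ(Y)` is inverse-closed: `realified_exists_inv_FΛ d T` (:= GA-02's `divisorMonoids_exists_inv_F₀` ★ p671144, re-read at `T'`).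
* **r3 `hZQ`** — every prime of `Φ₀(Y)` is `ℤ`- or `ℚ`-monoprime (Rmk. 3.3.1): `realified_isZQMonoprime d T` (:= `Or.inl` of GA-03's
  `isZMonoprime_submonoid_primes_divisorMonoids` ★ p672371).

No definition, no instance, no notation, no sorry; imports landed files only.  HONEST FRAMING: laws over typed interfaces at GA-02's (c3′)-labelled
carrier (⊕-DECOUPLED: constants GENUINE via `T.proj`, geometric factor = GA-10's DECREED, LABELLED finite-level envelope; [EtTh] Def 3.3 `Φ` at general `U`
and print's `Ÿ̈`/`μ_N` Kummer levels = FOUNDATIONS 13/14, not claimed); an UNDISPUTED construction around [IUTchIII] Cor. 3.12 at OUR typed objects;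
no side on the disputed step or on any author; typed ≠ inhabited ≠ proved-in-print; count-neutral; NO abc claim.
-/

noncomputable section

namespace Literature.AnabelianGeometry.EtaleTheta

open CategoryTheory Opposite Function Literature.AlgebraicGeometry.Frobenioids
  Literature.AlgebraicGeometry.Frobenioids.PadicFrd Literature.IUT.HodgeTheaters LogDivisorModel LogDivisorModel.GaloisAction

universe u v w

/-! ## §1 Isomorphism 2 of Prop. 3.4 (ii) is product-stable -/

namespace DivisorMonoids

variable {D₀ : Type u} [Category.{v} D₀] (T₁ T₂ : DivisorMonoids.{u, v, w} D₀)

/-- The product's divisor of `b = (b₁, b₂)` is the effective class of `x = (x₁, x₂)` iff each factor's divisor of `bᵢ` is the effective class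
of `xᵢ`. [cite: MochizukiEtTh2009, Def 3.3 p.73] -/
theorem prodDiv₀_eq_of_iff (Y : D₀ᵒᵖ) (b : T₁.B₀.obj Y × T₂.B₀.obj Y) (x : T₁.Φ₀.obj Y × T₂.Φ₀.obj Y) :
    prodDiv₀ T₁ T₂ Y b = Algebra.GrothendieckGroup.of x ↔
      T₁.div₀ Y b.1 = Algebra.GrothendieckGroup.of x.1 ∧ T₂.div₀ Y b.2 = Algebra.GrothendieckGroup.of x.2 := by
  constructor
  · intro h
    exact ⟨by rw [← prodDiv₀_fst T₁ T₂ Y b, h, gpMap_of, MonoidHom.coe_fst],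
      by rw [← prodDiv₀_snd T₁ T₂ Y b, h, gpMap_of, MonoidHom.coe_snd]⟩
  · rintro ⟨h₁, h₂⟩
    rw [prodDiv₀_apply, h₁, h₂, gpMap_of, gpMap_of, ← map_mul, MonoidHom.inl_apply, MonoidHom.inr_apply, Prod.mk_mul_mk,
      mul_one, one_mul]

/-- The `DivisorMonoids.prod` form: `div₀ (b₁, b₂) = of (x₁, x₂)` iff `div₀ bᵢ = of xᵢ` for both factors. [cite: MochizukiEtTh2009, Def 3.3 p.73] -/
theorem prod_div₀_eq_of_iff (Y : D₀ᵒᵖ) (b : T₁.B₀.obj Y × T₂.B₀.obj Y) (x : T₁.Φ₀.obj Y × T₂.Φ₀.obj Y) :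
    (T₁.prod T₂).div₀ Y b = Algebra.GrothendieckGroup.of x ↔
      T₁.div₀ Y b.1 = Algebra.GrothendieckGroup.of x.1 ∧ T₂.div₀ Y b.2 = Algebra.GrothendieckGroup.of x.2 :=
  prodDiv₀_eq_of_iff T₁ T₂ Y b x

/-- **Prop. 3.4 (ii), isomorphism 2 («a log-meromorphic function with EFFECTIVE log-divisor is constant»: `𝒪_L^▷ ≅ B₀ ×_{Φ₀^gp} Φ₀ ⊆ F₀`) is
product-stable**: it holds for `T₁.prod T₂` as soon as it holds for both factors. [cite: MochizukiEtTh2009, Prop 3.4 (ii) p.74] -/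
theorem prod_mem_F₀_of_div₀_eq_of
    (h₁ : ∀ (Y : D₀ᵒᵖ) (b : T₁.B₀.obj Y) (x : T₁.Φ₀.obj Y), T₁.div₀ Y b = Algebra.GrothendieckGroup.of x → b ∈ T₁.F₀ Y)
    (h₂ : ∀ (Y : D₀ᵒᵖ) (b : T₂.B₀.obj Y) (x : T₂.Φ₀.obj Y), T₂.div₀ Y b = Algebra.GrothendieckGroup.of x → b ∈ T₂.F₀ Y)
    (Y : D₀ᵒᵖ) (b : T₁.B₀.obj Y × T₂.B₀.obj Y) (x : T₁.Φ₀.obj Y × T₂.Φ₀.obj Y)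
    (hb : (T₁.prod T₂).div₀ Y b = Algebra.GrothendieckGroup.of x) : b ∈ (T₁.prod T₂).F₀ Y := by
  rw [prod_div₀_eq_of_iff] at hb
  exact ⟨h₁ Y b.1 x.1 hb.1, h₂ Y b.2 x.2 hb.2⟩

end DivisorMonoids

/-! ## §2 Isomorphism 2 at the engine `divisorMonoidsOf d T A hZ` and at THE ⊕ CARRIER `divisorMonoids d T` -/

namespace ArithThetaTower

variable {p : ℕ} [Fact p.Prime] (d : GaloisValDatum.{0} p) {P : Type} [Group P] [TopologicalSpace P]
  (T : BadLocalGroupDatum d.Gal P)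

section Engine

variable {Z : LogDivisorModel.{0}} (A : Z.GaloisAction P) (hZ : Z.CuspLaws)

/-- **Prop. 3.4 (ii), isomorphism 2, AT THE ENGINE for EVERY geometric input** (no hypothesis on `Z`): an element of
`B₀(U) = (Ω^{aug U})^× × Hom_Π(Π/U, Mero(Z))` whose divisor is EFFECTIVE lies in `F₀(U) = (Ω^{aug U})^× × Hom_Π(Π/U, L^×)` — the constants'
factor imposes nothing (`F₀ = ⊤`), and an equivariant family with effective «log-divisor of zeroes and poles» takes values in `𝒪^▷ ⊆ L^×`.
[cite: MochizukiEtTh2009, Prop 3.4 (ii) p.74] -/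
theorem divisorMonoidsOf_mem_F₀_of_div₀_eq_of (U : T.Dvᵒᵖ) (b : (divisorMonoidsOf d T A hZ).B₀.obj U)
    (x : (divisorMonoidsOf d T A hZ).Φ₀.obj U) (hb : (divisorMonoidsOf d T A hZ).div₀ U b = Algebra.GrothendieckGroup.of x) :
    b ∈ (divisorMonoidsOf d T A hZ).F₀ U :=
  DivisorMonoids.prod_mem_F₀_of_div₀_eq_of (constDivisorMonoids d T) (geomDivisorMonoids A hZ) (fun _ _ _ _ => trivial)
    (fun _ _ _ h => A.mem_fZero_of_divZeroHom_eq_of _ h) U b x hb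

/-- The geometric component of an element of `B₀(U)` with effective divisor has effective «log-divisor of zeroes and poles» (the second
projection of the hypothesis). [cite: MochizukiEtTh2009, Prop 3.4 (ii) p.74] -/
theorem divZeroHom_snd_eq_of_of_div₀_eq_of (U : T.Dvᵒᵖ) (b : ((constFld d T U.unop).K)ˣ × A.bZero ((cosetGSetFunctor P).obj U.unop))
    (x : OrdInt (constFld d T U.unop).K × A.phiZero ((cosetGSetFunctor P).obj U.unop))
    (hb : (divisorMonoidsOf d T A hZ).div₀ U b = Algebra.GrothendieckGroup.of x) :
    A.divZeroHom ((cosetGSetFunctor P).obj U.unop) b.2 = Algebra.GrothendieckGroup.of x.2 :=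
  ((DivisorMonoids.prod_div₀_eq_of_iff (constDivisorMonoids d T) (geomDivisorMonoids A hZ) U b x).1 hb).2

/-- **For a geometric model WITHOUT integral constants (`Z.intConst = ⊥` — the decreed theta envelopes) the geometric component of an element of
`B₀(U)` with EFFECTIVE divisor is TRIVIAL** (its values are log-meromorphic functions with effective divisor, i.e. in `𝒪^▷ = 1`).
[cite: MochizukiEtTh2009, Prop 3.4 (ii) p.74] -/
theorem divisorMonoidsOf_snd_eq_one_of_div₀_eq_of (hZi : Z.intConst = ⊥) (U : T.Dvᵒᵖ)
    (b : ((constFld d T U.unop).K)ˣ × A.bZero ((cosetGSetFunctor P).obj U.unop))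
    (x : OrdInt (constFld d T U.unop).K × A.phiZero ((cosetGSetFunctor P).obj U.unop))
    (hb : (divisorMonoidsOf d T A hZ).div₀ U b = Algebra.GrothendieckGroup.of x) : b.2 = 1 := by
  have h := divZeroHom_snd_eq_of_of_div₀_eq_of d T A hZ U b x hb
  have hint := (A.exists_divZeroHom_eq_of_iff _ b.2).1 ⟨x.2, h⟩
  refine Subtype.ext (funext fun s => ?_)
  have hs : (⟨b.2.1 s, b.2.2.1 s⟩ : Z.logMero).1 ∈ Z.intConst := hint s
  rw [hZi, Submonoid.mem_bot] at hs
  exact hs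

end Engine

/-- **Prop. 3.4 (ii), isomorphism 2, PROVED AT THE ⊕ CARRIER** `divisorMonoids d T` («`𝒪_L^▷ ⥲ B₀(Y) ×_{Φ₀(Y)^gp} Φ₀(Y)` lands in `F₀(Y)`»): an element
of `B₀(U)` whose divisor is EFFECTIVE is a genuine constant times a constant theta-envelope function — exactly the `hP34ii` hypothesis shape of
`RealifiedDivisorMonoids.ofRlfZWeak_mem_FΛ_of_divΛ_eq_of_iso₂`. [cite: MochizukiEtTh2009, Prop 3.4 (ii) p.74] -/
theorem divisorMonoids_mem_F₀_of_div₀_eq_of (U : T.Dvᵒᵖ) (b : (divisorMonoids d T).B₀.obj U) (x : (divisorMonoids d T).Φ₀.obj U)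
    (hb : (divisorMonoids d T).div₀ U b = Algebra.GrothendieckGroup.of x) : b ∈ (divisorMonoids d T).F₀ U :=
  divisorMonoidsOf_mem_F₀_of_div₀_eq_of d T _ _ U b x hb

/-- **At the ruled carrier the geometric component of an element of `B₀(U)` with effective divisor is TRIVIAL** (the envelope has `𝒪^▷ = 1`,
`envelope_intConst_eq_bot`), so such an element IS a genuine constant `(c, 1)`, `c ∈ (Ω^{aug U})^×` with `ord c ≥ 0`.
[cite: MochizukiEtTh2009, Prop 3.4 (ii) p.74] -/
theorem divisorMonoids_snd_eq_one_of_div₀_eq_of (U : T.Dvᵒᵖ)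
    (b : ((constFld d T U.unop).K)ˣ × (deckAction d T).bZero ((cosetGSetFunctor P).obj U.unop))
    (x : OrdInt (constFld d T U.unop).K × (deckAction d T).phiZero ((cosetGSetFunctor P).obj U.unop))
    (hb : (divisorMonoids d T).div₀ U b = Algebra.GrothendieckGroup.of x) : b.2 = 1 :=
  divisorMonoidsOf_snd_eq_one_of_div₀_eq_of d T _ _ (envelope_intConst_eq_bot d T) U b x hb

/-- The constants' coordinate of an element of `B₀(U)` with effective divisor `of (x₁, x₂)` has valuation `of x₁` — i.e. it is an INTEGRAL genuine
constant (`𝒪^▷_{Ω^{aug U}}`). [cite: MochizukiEtTh2009, Prop 3.4 (ii) p.74] -/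
theorem divUnits_fst_eq_of_of_div₀_eq_of (U : T.Dvᵒᵖ)
    (b : ((constFld d T U.unop).K)ˣ × (deckAction d T).bZero ((cosetGSetFunctor P).obj U.unop))
    (x : OrdInt (constFld d T U.unop).K × (deckAction d T).phiZero ((cosetGSetFunctor P).obj U.unop))
    (hb : (divisorMonoids d T).div₀ U b = Algebra.GrothendieckGroup.of x) :
    divUnits (constFld d T U.unop).K b.1 = Algebra.GrothendieckGroup.of x.1 :=
  ((DivisorMonoids.prod_div₀_eq_of_iff (constDivisorMonoids d T) (divisorsGeom P (Cpt d T)) U b x).1 hb).1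

/-! ## §3 The r1–r3 residuals AT THE TERM's realified data `T' := realified d T` (and at the engine's `realifiedOf d T A hZ`), BY NAME -/

section EngineRealified

variable {Z : LogDivisorModel.{0}} (A : Z.GaloisAction P) (hZ : Z.CuspLaws)

/-- **r1 `hP34Λ` at the engine's realified data**: Prop. 3.4 (ii), isomorphism 2, lifted to `realifiedOf d T A hZ = ofRlfZWeak (divisorMonoidsOf …) _`
(an element of `B₀^ℤ(Y)` whose image in `(Φ₀^ℝ)^gp(Y)` is effective is already effective in `Φ₀^gp(Y)`, hence in `F₀^ℤ(Y)`).
[cite: MochizukiEtTh2009, Prop 3.4 (ii) p.74] -/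
theorem realifiedOf_mem_FΛ_of_divΛ_eq_of (Y : T.Dvᵒᵖ) (b : (realifiedOf d T A hZ).BΛ.obj Y) (r : (realifiedOf d T A hZ).ΦR.obj Y)
    (h : (realifiedOf d T A hZ).divΛ Y b = Algebra.GrothendieckGroup.of r) : b ∈ (realifiedOf d T A hZ).FΛ Y :=
  RealifiedDivisorMonoids.ofRlfZWeak_mem_FΛ_of_divΛ_eq_of_iso₂ (divisorMonoidsOf d T A hZ) (isPerfFactorial_divisorMonoidsOf d T A hZ)
    (divisorMonoidsOf_mem_F₀_of_div₀_eq_of d T A hZ) Y b r h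

/-- **r2 `hFinv` at the engine's realified data**: `F₀^ℤ(Y)` is inverse-closed. [cite: MochizukiEtTh2009, Def 3.6 p.76] -/
theorem realifiedOf_exists_inv_FΛ (Y : T.Dvᵒᵖ) (b : (realifiedOf d T A hZ).BΛ.obj Y) (hb : b ∈ (realifiedOf d T A hZ).FΛ Y) :
    ∃ b' ∈ (realifiedOf d T A hZ).FΛ Y, b' * b = 1 :=
  divisorMonoidsOf_exists_inv_F₀ d T A hZ Y b hb

/-- **r3 `hZQ` at the engine's realified data**: every prime of `Φ₀(Y)` is `ℤ`-monoprime (Rmk. 3.3.1), in the `ℤ ∨ ℚ` shape of the one-calls.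
[cite: MochizukiEtTh2009, Rmk 3.3.1 p.73] -/
theorem realifiedOf_isZQMonoprime (Y : T.Dvᵒᵖ) (𝔭 : Primes ((realifiedOf d T A hZ).Φ₀.obj Y)) :
    IsZMonoprime ↥𝔭.submonoid ∨ IsQMonoprime ↥𝔭.submonoid :=
  Or.inl (isZMonoprime_submonoid_primes_divisorMonoidsOf d T A hZ Y 𝔭)

end EngineRealified

/-- **r1 `hP34Λ` AT THE TERM** — Prop. 3.4 (ii), isomorphism 2, at `T' := realified d T` in the VERBATIM binder shape of `cor38ii_h5_of_carrierSpec` /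
`cor38ii_hR` / `hull_selfEquivalence_of_carrierSpec_of_pullDichotomy_of_isSlimGroup`: an element of `B₀^Λ(Y)` whose image in `(Φ₀^ℝ)^gp(Y)` is
effective lies in `F₀^Λ(Y)`. [cite: MochizukiEtTh2009, Prop 3.4 (ii) p.74] -/
theorem realified_mem_FΛ_of_divΛ_eq_of (Y : T.Dvᵒᵖ) (b : (realified d T).BΛ.obj Y) (r : (realified d T).ΦR.obj Y)
    (h : (realified d T).divΛ Y b = Algebra.GrothendieckGroup.of r) : b ∈ (realified d T).FΛ Y :=
  RealifiedDivisorMonoids.ofRlfZWeak_mem_FΛ_of_divΛ_eq_of_iso₂ (divisorMonoids d T) (isPerfFactorial_divisorMonoids d T)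
    (divisorMonoids_mem_F₀_of_div₀_eq_of d T) Y b r h

/-- `realified_mem_FΛ_of_divΛ_eq_of` IS the engine's `realifiedOf_mem_FΛ_of_divΛ_eq_of` at the theta envelope (`realified_eq_realifiedOf`).
[cite: MochizukiEtTh2009, Prop 3.4 (ii) p.74] -/
theorem realified_mem_FΛ_of_divΛ_eq_of_eq :
    realified_mem_FΛ_of_divΛ_eq_of d T = realifiedOf_mem_FΛ_of_divΛ_eq_of d T (deckAction d T) (Envelope.cuspLaws (Cpt d T)) := rfl

/-- **r2 `hFinv` AT THE TERM** — `F₀^Λ(Y)` of `realified d T` is inverse-closed (GA-02's `divisorMonoids_exists_inv_F₀`, re-read through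
`realified_BΛ`/`realified_FΛ`), in the VERBATIM binder shape of the one-calls. [cite: MochizukiEtTh2009, Def 3.6 p.76] -/
theorem realified_exists_inv_FΛ (Y : T.Dvᵒᵖ) (b : (realified d T).BΛ.obj Y) (hb : b ∈ (realified d T).FΛ Y) :
    ∃ b' ∈ (realified d T).FΛ Y, b' * b = 1 :=
  divisorMonoids_exists_inv_F₀ d T Y b hb

/-- **r3 `hZQ` AT THE TERM** — every prime of `Φ₀(Y)` of `realified d T` is `ℤ`-monoprime (GA-03's `isZMonoprime_submonoid_primes_divisorMonoids`,
Rmk. 3.3.1), in the VERBATIM `ℤ ∨ ℚ` binder shape of the one-calls. [cite: MochizukiEtTh2009, Rmk 3.3.1 p.73] -/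
theorem realified_isZQMonoprime (Y : T.Dvᵒᵖ) (𝔭 : Primes ((realified d T).Φ₀.obj Y)) :
    IsZMonoprime ↥𝔭.submonoid ∨ IsQMonoprime ↥𝔭.submonoid :=
  Or.inl (isZMonoprime_submonoid_primes_divisorMonoids d T Y 𝔭)

end ArithThetaTower

end Literature.AnabelianGeometry.EtaleTheta

end
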